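import Summits.Ventures.PercRepro.RankLevelSetPerElemThreeClass
import Summits.Ventures.PercRepro.RankLevelSetStarPlusLow

/-! # RankLevelSetAbsorbNormClass — (★★)⁺ AND (ABS-norm) ON EVERY MATROID WITH AT MOST `7` ELEMENTS AND ON EVERY
MATROID OF RANK AT MOST `4` (night-1 g36; dossier §48.7; on `RankLevelSetPerElemThreeClass` and
`RankLevelSetStarPlusLow`)

(ABS-norm) — the full normalized half rule `A^y_i · C(#E, j) ≤ A^y_j · C(#E, i)` (`i < j`, `i + j ≤ #E`) of the
absorbing avoid-`y` profile — is the conjunction of the steps (ABS-star) and the reflections (★★)⁺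
(`absorbNormSkew_of_absorbStar`). The reflections `A^y_i ≤ A^y_{#E − i}` are theorems at `i ≤ 2`
(`starPlus_one`, `starPlus_two`, and `A^y_0 = 0`), and at `i = 3` on `7` elements they are the middle step `k = 3`
(`absorbStar_step_three_all`). Hence (★★)⁺ and (ABS-norm) hold on every matroid with `#E ≤ 7`
(**`biIndepStarPlus_of_ncard_le_seven`**, **`absorbNormSkew_of_ncard_le_seven`**) and, since a reflection `i ≥ 3`
with `2i < #E` on a matroid of rank `≤ 4` is either that middle step or has `A^y_i = 0` (an absorbing `i`-set has
an independent complement of `#E − i ≥ 5` elements), on every matroid of rank `≤ 4`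
(**`biIndepStarPlus_of_eRank_le_four`**, **`absorbNormSkew_of_eRank_le_four`**, with `absorbStar_of_eRank_le_four`).
Every declaration has a docstring; imports: the cell's own modules and Mathlib only. Axioms: standard. -/

namespace PercRepro

open Set Matroid

variable {α : Type} (M : Matroid α) [M.Finite]

/-! ## Vanishing of the absorbing profile, and the low reflections -/

/-- `A^y_k = 0` when `#E − k` exceeds the rank (the complement of an absorbing `k`-set is independent). -/
lemma lowAbsorbCount_eq_zero_of_eRank_lt {y : α} {k : ℕ} (hr : M.eRank < ((M.E.ncard - k : ℕ) : ℕ∞)) :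
    lowAbsorbCount M y k = 0 := by
  unfold lowAbsorbCount
  have hempty : lowAbsorbAt M y k = ∅ := by
    rw [Set.eq_empty_iff_forall_notMem]
    rintro Z ⟨hZ, -, -⟩
    rw [biIndep_eq_empty_of_eRank_lt M hr] at hZ
    exact hZ
  rw [hempty, Set.ncard_empty]

/-- **(★★)⁺ at every `i ≤ 2`**: `A^y_i ≤ A^y_{#E − i}` for `2i < #E`. -/
theorem starPlus_of_le_two {y : α} (hy : y ∈ M.E) {i : ℕ} (hi : i ≤ 2) (h2 : 2 * i < M.E.ncard) :
    lowAbsorbCount M y i ≤ lowAbsorbCount M y (M.E.ncard - i) := by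
  interval_cases i
  · rw [lowAbsorbCount_zero M hy]
    exact Nat.zero_le _
  · exact starPlus_one M hy (by omega)
  · exact starPlus_two M hy (by omega)

/-- **(★★)⁺ at `i = 3` on `7` elements** is the middle step `k = 3` of (ABS-star): `A^y_3 ≤ A^y_4`. -/
theorem starPlus_three_of_ncard_eq_seven [DecidableEq α] {y : α} (hy : y ∈ M.E) (hn : M.E.ncard = 7) :
    lowAbsorbCount M y 3 ≤ lowAbsorbCount M y (M.E.ncard - 3) := by
  have h := absorbStar_step_three_all M hy (by omega)
  rw [hn] at h ⊢
  have h3 : (7 - 4 : ℕ) = 3 := by norm_num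
  rw [h3] at h
  rw [show (7 - 3 : ℕ) = 4 by norm_num]
  omega

/-! ## Matroids with at most `7` elements -/

/-- **(★★)⁺ holds on every matroid with at most `7` elements**: the reflections in range are `i ≤ 3`, and `i = 3`
occurs only on `7` elements, where it is the middle step. -/
theorem biIndepStarPlus_of_ncard_le_seven [DecidableEq α] (hn : M.E.ncard ≤ 7) : BiIndepStarPlus M := by
  intro y hy i hi
  rcases Nat.lt_or_ge i 3 with h3 | h3
  · exact starPlus_of_le_two M hy (by omega) hi
  · have hi3 : i = 3 := by omega
    subst hi3
    exact starPlus_three_of_ncard_eq_seven M hy (by omega)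

/-- **(ABS-norm) holds on every matroid with at most `7` elements**: the steps (`absorbStar_of_ncard_le_eight`)
and the reflections (`biIndepStarPlus_of_ncard_le_seven`). -/
theorem absorbNormSkew_of_ncard_le_seven [DecidableEq α] (hn : M.E.ncard ≤ 7) : BiIndepAbsorbNormSkew M :=
  absorbNormSkew_of_absorbStar M (absorbStar_of_ncard_le_eight M (by omega))
    (biIndepStarPlus_of_ncard_le_seven M hn)

/-! ## Matroids of rank at most `4` -/

/-- **(★★)⁺ holds on every matroid of rank at most `4`**: a reflection `i ≥ 3` with `2i < #E` is the middle step
on `7` elements or has `#E − i ≥ 5 > 4 ≥ eRank`, where `A^y_i = 0`. -/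
theorem biIndepStarPlus_of_eRank_le_four [DecidableEq α] (hr : M.eRank ≤ 4) : BiIndepStarPlus M := by
  intro y hy i hi
  rcases Nat.lt_or_ge i 3 with h3 | h3
  · exact starPlus_of_le_two M hy (by omega) hi
  · rcases Nat.lt_or_ge (M.E.ncard - i) 5 with h5 | h5
    · have hi3 : i = 3 := by omega
      have hn7 : M.E.ncard = 7 := by omega
      subst hi3
      exact starPlus_three_of_ncard_eq_seven M hy hn7
    · have h4 : ((4 : ℕ) : ℕ∞) < ((M.E.ncard - i : ℕ) : ℕ∞) := by exact_mod_cast (by omega : (4 : ℕ) < M.E.ncard - i)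
      rw [lowAbsorbCount_eq_zero_of_eRank_lt M (lt_of_le_of_lt hr h4)]
      exact Nat.zero_le _

/-- **(ABS-norm) holds on every matroid of rank at most `4`**: the steps (`absorbStar_of_eRank_le_four`) and the
reflections (`biIndepStarPlus_of_eRank_le_four`). -/
theorem absorbNormSkew_of_eRank_le_four [DecidableEq α] (hr : M.eRank ≤ 4) : BiIndepAbsorbNormSkew M :=
  absorbNormSkew_of_absorbStar M (absorbStar_of_eRank_le_four M hr) (biIndepStarPlus_of_eRank_le_four M hr)

end PercRepro
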